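import Summits.CriticalPhenomena.PercolationContinuityZ3.Theorems.PercNearOneGluingNoHeavyQuantFarSunGameSound
import Mathlib.Data.Nat.Cast.Field
import Mathlib.Tactic.FieldSimp
import Mathlib.Tactic.Ring
import Mathlib.Tactic.Linarith
import Mathlib.Tactic.Positivity
import HarnessLib

/-!
# FAR beyond trees: the λ-REFINED budget game (payoff `f − λ·𝟙[T ≤ 2]`) with THRESHOLD certificates — definitions and soundness

builds on p205010 (kernel theorem, internal audit signed; external expert review pending)

Support file (`--supports stmt-CriticalPhenomena-4575`), seat `prim-cert-1` (gen 39); memo `prim-cert-1/FROM-prim-cert-1-g39-VERTEX-GAME.md` §5, §7.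
For the `K = 12` high-mass cells the plain game is too weak; on `R` one has `P(T ≤ 2) = 1 − F > c(η, Σ)`, so the game with payoff `f − λ·𝟙[T ≤ 2]`
(λ = `lamN/lamD`) plus a budget-wise THRESHOLD `t_B ≈ −λ·c·q^K·Lpay` certifies `G_avg ≥ 1`.  This file: `FSt.payNumL`/`FSt.payL`, `autoEL`, `GameSpec.baseValL`,
`gameArrL`, `gameLayerL`, `gameCertT` (thresholds), and the soundness theorems `gameLayerL_sound`, `autoEL_ge_of_gameCertT` (copies of …GameSound's proofs; the
Bellman step `stepVal`, the tables and `startOf` are reused unchanged).  Elementary [this work]; no sorries; standard axioms.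
-/

namespace Summit.CriticalPhenomena.PercolationContinuityZ3.Theorems.HairyCycle

open Finset

namespace FSt

/-- λ-refined payoff `pay − (lamN/lamD)·𝟙[A ≤ 2]`. [this work] -/
noncomputable def payL (Amax Kcred : ℕ) (lamN lamD : ℕ) (s : FSt) : ℝ :=
  s.pay Amax Kcred - (if s.A ≤ 2 then (lamN : ℝ) / lamD else 0)

/-- Its integer numerator over `L` (`lamD ∣ L`). [this work] -/
def payNumL (Amax Kcred L lamN lamD : ℕ) (s : FSt) : ℤ :=
  s.payNum Amax Kcred L - (if s.A ≤ 2 then (((L / lamD) * lamN : ℕ) : ℤ) else 0)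

end FSt

/-- Mean λ-refined payoff of the flank automaton (as `autoE`). [this work] -/
noncomputable def autoEL (Amax C Cc Kcred lamN lamD : ℕ) : FSt → List ℝ → ℝ
  | s, [] => s.payL Amax Kcred lamN lamD
  | s, p :: ps => p * autoEL Amax C Cc Kcred lamN lamD (s.op Amax Cc) ps + (1 - p) * autoEL Amax C Cc Kcred lamN lamD (s.cl C) ps

namespace GameSpec

variable (P : GameSpec)

/-- Base layer of the λ-refined game. [this work] -/
def baseValL (lamN lamD : ℕ) (s : FSt) (a b B : ℕ) : Option ℤ :=
  if B = 0 then
    some (let ka : ℤ := P.kOf a; let kb : ℤ := P.kOf b; let qq : ℤ := P.q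
      let so := s.op P.Amax P.Cc; let sc := s.cl P.C
      ka * (kb * (so.op P.Amax P.Cc).payNumL P.Amax P.Kcred P.Lpay lamN lamD + (qq - kb) * (so.cl P.C).payNumL P.Amax P.Kcred P.Lpay lamN lamD) +
        (qq - ka) * (kb * (sc.op P.Amax P.Cc).payNumL P.Amax P.Kcred P.Lpay lamN lamD + (qq - kb) * (sc.cl P.C).payNumL P.Amax P.Kcred P.Lpay lamN lamD))
  else none

/-- Layers of the λ-refined game (same Bellman step). [this work] -/
def gameArrL (lamN lamD NB n : ℕ) : Array (Option ℤ) := P.gameIter NB n (P.tabulate NB (P.baseValL lamN lamD))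

/-- Layer `n` as a function. [this work] -/
def gameLayerL (lamN lamD NB n : ℕ) : FSt → ℕ → ℕ → ℕ → Option ℤ := P.lookup NB (P.gameArrL lamN lamD NB n)

/-- **Threshold certificate**: for each listed `(B, t)`, the start value at budget `B` is `≥ t` (or no word). [this work] -/
def gameCertT (lamN lamD NB K : ℕ) (Bt : List (ℕ × ℤ)) : Bool :=
  let T := P.gameArrL lamN lamD NB (K - 2)
  Bt.all fun bt => match P.startOf NB T bt.1 with
    | some v => decide (bt.2 ≤ v)
    | none => true

/-! ## Soundness (copies of …GameSound) -/

section Sound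

variable {P} {lamN lamD : ℕ}

/-- Layer `0` of the λ-game is its base layer. [this work] -/
theorem gameLayerL_zero {NB lamN lamD : ℕ} {s : FSt} {a b B : ℕ} (h : P.InRange NB s a b B) :
    P.gameLayerL lamN lamD NB 0 s a b B = P.baseValL lamN lamD s a b B := by
  unfold GameSpec.gameLayerL GameSpec.gameArrL
  rw [GameSpec.gameIter]
  exact lookup_tabulate _ h

/-- Layer `n+1` of the λ-game is the Bellman step applied to layer `n`. [this work] -/
theorem gameLayerL_succ {NB lamN lamD n : ℕ} {s : FSt} {a b B : ℕ} (h : P.InRange NB s a b B) :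
    P.gameLayerL lamN lamD NB (n + 1) s a b B = P.stepVal (P.gameLayerL lamN lamD NB n) s a b B := by
  unfold GameSpec.gameLayerL GameSpec.gameArrL
  rw [gameIter_succ, lookup_tabulate _ h]

/-- The integer payoff numerator is `Lpay ×` the real payoff (for any state). [this work] -/
theorem payNumL_cast (W : P.WF) (hlam : lamD ∣ P.Lpay) (hlamD : 0 < lamD) (s : FSt) :
    ((s.payNumL P.Amax P.Kcred P.Lpay lamN lamD : ℤ) : ℝ) = (P.Lpay : ℝ) * s.payL P.Amax P.Kcred lamN lamD := by
  unfold FSt.payNumL FSt.payL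
  rw [Int.cast_sub, payNum_cast W s, mul_sub]
  congr 1
  have hd0 : (lamD : ℝ) ≠ 0 := by exact_mod_cast hlamD.ne'
  split_ifs
  · have e : (((P.Lpay / lamD * lamN : ℕ) : ℤ) : ℝ) = ((P.Lpay / lamD * lamN : ℕ) : ℝ) := by norm_cast
    rw [e, Nat.cast_mul, Nat.cast_div hlam hd0]
    field_simp
  · simp

/-- Unfolding `autoEL` on a nonempty word. -/
theorem autoEL_cons (Amax C Cc Kcred : ℕ) (s : FSt) (p : ℝ) (ps : List ℝ) :
    autoEL Amax C Cc Kcred lamN lamD s (p :: ps) = p * autoEL Amax C Cc Kcred lamN lamD (s.op Amax Cc) ps + (1 - p) * autoEL Amax C Cc Kcred lamN lamD (s.cl C) ps := rfl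

/-- Unfolding `autoE` on the empty word. -/
theorem autoEL_nil (Amax C Cc Kcred : ℕ) (s : FSt) : autoEL Amax C Cc Kcred lamN lamD s [] = s.payL Amax Kcred lamN lamD := rfl

/-- **SOUNDNESS OF THE GAME TABLE.**  For every word `i₁ … i_n` over the alphabet with total weight `B ≤ NB`, every in-range state `s` and pending
letters `a`, `b`: layer `n` at `(s, a, b, B)` is `some v` with `v ≤ q^(n+2) · Lpay · autoE s (g_a, g_b, g_{i₁}, …, g_{i_n})` — the adversary of the
delay-2 game may always play the fixed word. [this work] -/
theorem gameLayerL_sound (W : P.WF) (hlam : lamD ∣ P.Lpay) (hlamD : 0 < lamD) (NB : ℕ) :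
    ∀ (n : ℕ) (word : List ℕ) (s : FSt) (a b B : ℕ), s.Valid P.Amax P.C P.Cc → a < P.nL → b < P.nL → (∀ i ∈ word, i < P.nL) →
      word.length = n → (word.map P.wOf).sum = B → B ≤ NB →
      ∃ v, P.gameLayerL lamN lamD NB n s a b B = some v ∧
        (v : ℝ) ≤ (P.q : ℝ) ^ (n + 2) * P.Lpay * autoEL P.Amax P.C P.Cc P.Kcred lamN lamD s (P.gOf a :: P.gOf b :: word.map P.gOf) := by
  intro n
  induction n with
  | zero =>
    intro word s a b B hs ha hb _ hlen hsum hB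
    have hw : word = [] := List.eq_nil_of_length_eq_zero hlen
    subst hw
    simp only [List.map_nil, List.sum_nil] at hsum
    subst hsum
    have hR : P.InRange NB s a b 0 := ⟨hs.1, hs.2.1, hs.2.2.1, hs.2.2.2, ha, hb, Nat.zero_le _⟩
    rw [gameLayerL_zero (lamN := lamN) (lamD := lamD) hR]
    unfold GameSpec.baseValL
    rw [if_pos rfl]
    refine ⟨_, rfl, le_of_eq ?_⟩
    simp only [List.map_nil, autoEL_cons, autoEL_nil]
    have hoo := payNumL_cast (lamN := lamN) W hlam hlamD ((s.op P.Amax P.Cc).op P.Amax P.Cc)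
    have hoc := payNumL_cast (lamN := lamN) W hlam hlamD ((s.op P.Amax P.Cc).cl P.C)
    have hco := payNumL_cast (lamN := lamN) W hlam hlamD ((s.cl P.C).op P.Amax P.Cc)
    have hcc := payNumL_cast (lamN := lamN) W hlam hlamD ((s.cl P.C).cl P.C)
    unfold GameSpec.gOf
    have hq : (P.q : ℝ) ≠ 0 := by exact_mod_cast (ne_of_gt W.q_pos)
    push_cast
    rw [hoo, hoc, hco, hcc]
    field_simp
  | succ n ih =>
    intro word s a b B hs ha hb hword hlen hsum hB
    obtain ⟨i, rest, rfl⟩ : ∃ i rest, word = i :: rest := by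
      cases word with
      | nil => simp at hlen
      | cons i rest => exact ⟨i, rest, rfl⟩
    have hi : i < P.nL := hword i (List.mem_cons_self)
    have hrest : ∀ i' ∈ rest, i' < P.nL := fun i' hi' => hword i' (List.mem_cons_of_mem _ hi')
    have hlen' : rest.length = n := by simpa using hlen
    simp only [List.map_cons, List.sum_cons] at hsum
    have hwi : P.wOf i ≤ B := by omega
    have hsum' : (rest.map P.wOf).sum = B - P.wOf i := by omega
    have hR : P.InRange NB s a b B := ⟨hs.1, hs.2.1, hs.2.2.1, hs.2.2.2, ha, hb, hB⟩
    rw [gameLayerL_succ (lamN := lamN) (lamD := lamD) hR]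
    -- the two continuation values given by the induction hypothesis
    obtain ⟨u, hu, hule⟩ := ih rest (s.op P.Amax P.Cc) b i (B - P.wOf i) (valid_op hs) hb hi hrest hlen' hsum' (by omega)
    obtain ⟨u', hu', hu'le⟩ := ih rest (s.cl P.C) b i (B - P.wOf i) (valid_cl hs) hb hi hrest hlen' hsum' (by omega)
    -- the term of letter `i` in the Bellman minimum
    set g : ℕ → Option ℤ := fun i' =>
      match P.gameLayerL lamN lamD NB n (s.op P.Amax P.Cc) b i' (B - P.wOf i'), P.gameLayerL lamN lamD NB n (s.cl P.C) b i' (B - P.wOf i') with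
      | some x, some y => some ((P.kOf a : ℤ) * x + ((P.q : ℤ) - P.kOf a) * y)
      | _, _ => none with hg
    have hgi : g i = some ((P.kOf a : ℤ) * u + ((P.q : ℤ) - P.kOf a) * u') := by
      simp only [hg, hu, hu']
    have hstep : P.stepVal (P.gameLayerL lamN lamD NB n) s a b B =
        (List.range P.nL).foldl (fun acc i' => if P.wOf i' ≤ B then GameSpec.omin acc (g i') else acc) none := rfl
    rw [hstep]
    obtain ⟨v, hv, hvle⟩ := foldl_omin_le g (fun i' => P.wOf i' ≤ B) (List.range P.nL) none (List.mem_range.2 hi) hwi hgi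
    refine ⟨v, hv, ?_⟩
    have hka : (P.kOf a : ℝ) ≤ P.q := by exact_mod_cast W.k_le a ha
    have hq : (P.q : ℝ) ≠ 0 := by exact_mod_cast (ne_of_gt W.q_pos)
    have hv' : (v : ℝ) ≤ (P.kOf a : ℝ) * u + ((P.q : ℝ) - P.kOf a) * u' := by exact_mod_cast hvle
    simp only [List.map_cons]
    rw [autoEL_cons]
    have h1 : (P.kOf a : ℝ) * (u : ℝ) ≤ (P.kOf a : ℝ) * ((P.q : ℝ) ^ (n + 2) * P.Lpay *
        autoEL P.Amax P.C P.Cc P.Kcred lamN lamD (s.op P.Amax P.Cc) (P.gOf b :: P.gOf i :: rest.map P.gOf)) :=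
      mul_le_mul_of_nonneg_left hule (Nat.cast_nonneg _)
    have h2 : ((P.q : ℝ) - P.kOf a) * (u' : ℝ) ≤ ((P.q : ℝ) - P.kOf a) * ((P.q : ℝ) ^ (n + 2) * P.Lpay *
        autoEL P.Amax P.C P.Cc P.Kcred lamN lamD (s.cl P.C) (P.gOf b :: P.gOf i :: rest.map P.gOf)) :=
      mul_le_mul_of_nonneg_left hu'le (by linarith)
    have hg' : P.gOf a = (P.kOf a : ℝ) / P.q := rfl
    rw [hg']
    calc (v : ℝ) ≤ (P.kOf a : ℝ) * u + ((P.q : ℝ) - P.kOf a) * u' := hv'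
      _ ≤ _ := add_le_add h1 h2
      _ = _ := by field_simp; ring

/-- **THRESHOLD CERTIFICATE ⇒ LOWER BOUND.**  If `gameCertT NB K Bt = true` and `(B, t) ∈ Bt` for the weight `B ≤ NB` of a word of length `K ≥ 2`, then
`t ≤ q^K · Lpay · autoEL start (word)`. [this work] -/
theorem autoEL_ge_of_gameCertT (W : P.WF) (hlam : lamD ∣ P.Lpay) (hlamD : 0 < lamD) {NB K : ℕ} {Bt : List (ℕ × ℤ)}
    (hc : P.gameCertT lamN lamD NB K Bt = true) (hK : 2 ≤ K)
    (word : List ℕ) (hw : ∀ i ∈ word, i < P.nL) (hlen : word.length = K) {t : ℤ} (hBt : ((word.map P.wOf).sum, t) ∈ Bt)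
    (hNB : (word.map P.wOf).sum ≤ NB) :
    (t : ℝ) ≤ (P.q : ℝ) ^ K * P.Lpay * autoEL P.Amax P.C P.Cc P.Kcred lamN lamD FSt.start (word.map P.gOf) := by
  obtain ⟨a, b, rest, rfl⟩ : ∃ a b rest, word = a :: b :: rest := by
    match word, hlen with
    | a :: b :: rest, _ => exact ⟨a, b, rest, rfl⟩
    | [], h => simp at h; omega
    | [_], h => simp at h; omega
  have ha : a < P.nL := hw a (by simp)
  have hb : b < P.nL := hw b (by simp)
  have hrest : ∀ i ∈ rest, i < P.nL := fun i hi => hw i (by simp [hi])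
  set B := ((a :: b :: rest).map P.wOf).sum with hBdef
  have hBeq : B = P.wOf a + P.wOf b + (rest.map P.wOf).sum := by simp [hBdef, add_assoc]
  have hvalid : FSt.start.Valid P.Amax P.C P.Cc := ⟨Nat.zero_le _, Nat.zero_le _, Nat.zero_le _, Nat.zero_le _⟩
  obtain ⟨tv, htv, htvle⟩ := gameLayerL_sound W hlam hlamD NB (K - 2) rest FSt.start a b (B - P.wOf a - P.wOf b) hvalid ha hb hrest
    (by simp at hlen; omega) (by omega) (by omega)
  have hab : P.wOf a + P.wOf b ≤ B := by omega
  unfold GameSpec.gameLayerL at htv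
  obtain ⟨v, hv, hvt⟩ := startOf_le (P.gameArrL lamN lamD NB (K - 2)) ha hb hab htv
  -- the certificate says `t ≤ v`
  unfold GameSpec.gameCertT at hc
  simp only [List.all_eq_true] at hc
  have hcB := hc (B, t) hBt
  simp only [hv, decide_eq_true_eq] at hcB
  have hK2 : K - 2 + 2 = K := Nat.sub_add_cancel hK
  rw [hK2] at htvle
  have h1 : (t : ℝ) ≤ (tv : ℝ) := by exact_mod_cast hcB.trans hvt
  simpa [List.map_cons] using h1.trans htvle

end Sound

end GameSpec

end Summit.CriticalPhenomena.PercolationContinuityZ3.Theorems.HairyCycle
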